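import Mathlib

/-!
# Nearest-neighbour Bernoulli bond percolation on ℤ^d — definitions and the target statement

Cell pub-perc-repro0, seat p2.  This file fixes, in Lean, the objects named in the brief:

* the hypercubic lattice ℤ^d (`Vertex d = Fin d → ℤ`) and its nearest-neighbour bonds (`Bond d`),
* the product Bernoulli(p) measure `percMeasure d p` on configurations `Bond d → Bool`
  (`MeasureTheory.Measure.infinitePi` of `ProbabilityTheory.bernoulliMeasure`),
* open paths, the open cluster `cluster ω` of the origin,
* the percolation probability `θ d p = P_p(|C(0)| = ∞)` and the critical probability
  `pc d = inf {p ∈ [0,1] : θ d p > 0}` (ROUTE-v1 §0),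
* the target `Target : ∀ d ≥ 2, θ d (pc d) = 0`.

Nothing here is proved about the target; the file only makes the statement precise.
-/

open MeasureTheory ProbabilityTheory

namespace Summit.Ventures.PercRepro0

/-- A vertex of the hypercubic lattice `ℤ^d`. -/
abbrev Vertex (d : ℕ) := Fin d → ℤ

/-- A nearest-neighbour bond of `ℤ^d`, represented by its "lower" endpoint `x` and the direction
`i`: the bond `(x, i)` joins `x` and `x + e_i`.  Every unoriented nearest-neighbour bond `{y, z}`
(with `‖y - z‖₁ = 1`) has exactly one such representation (take `x` to be the endpoint whose
`i`-th coordinate is smaller), so `Bond d` is in bijection with the edge set of `ℤ^d`. -/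
abbrev Bond (d : ℕ) := Vertex d × Fin d

variable {d : ℕ}

/-- The first endpoint `x` of the bond `(x, i)`. -/
def Bond.src (b : Bond d) : Vertex d := b.1

/-- The second endpoint `x + e_i` of the bond `(x, i)`. -/
def Bond.tgt (b : Bond d) : Vertex d := Function.update b.1 b.2 (b.1 b.2 + 1)

/-- A configuration: every bond is open (`true`) or closed (`false`). -/
abbrev Config (d : ℕ) := Bond d → Bool

/-- The percolation measure `P_p`: the bonds are independent, each open with probability `p`
(`p ∈ [0,1]`).  This is the infinite product of the Bernoulli measures `Ber(true, false, p)`. -/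
noncomputable def percMeasure (d : ℕ) (p : unitInterval) : Measure (Config d) :=
  Measure.infinitePi (fun _ : Bond d => bernoulliMeasure true false p)

/-- `P_p` is a probability measure (an infinite product of probability measures). -/
instance (p : unitInterval) : IsProbabilityMeasure (percMeasure d p) := by
  unfold percMeasure; infer_instance

/-- `OpenAdj ω x y`: `x` and `y` are joined by an open bond of `ω`. -/
def OpenAdj (ω : Config d) (x y : Vertex d) : Prop :=
  ∃ b : Bond d, ω b = true ∧ ((b.src = x ∧ b.tgt = y) ∨ (b.src = y ∧ b.tgt = x))

/-- `Conn ω x y`: there is an open path from `x` to `y` (the reflexive–transitive closure of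
`OpenAdj ω`). -/
def Conn (ω : Config d) : Vertex d → Vertex d → Prop :=
  Relation.ReflTransGen (OpenAdj ω)

/-- The open cluster of the origin. -/
def cluster (ω : Config d) : Set (Vertex d) := {x | Conn ω 0 x}

/-- The event `{|C(0)| = ∞}` that the origin lies in an infinite open cluster. -/
def InfCluster (d : ℕ) : Set (Config d) := {ω | (cluster ω).Infinite}

/-- The percolation probability `θ(p) = P_p(|C(0)| = ∞)`, as a real number. -/
noncomputable def θ (d : ℕ) (p : unitInterval) : ℝ := (percMeasure d p).real (InfCluster d)

/-- The set `{p ∈ [0,1] : θ_d(p) > 0}` whose infimum is the critical probability. -/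
def posSet (d : ℕ) : Set ℝ := {p : ℝ | ∃ hp : p ∈ unitInterval, 0 < θ d ⟨p, hp⟩}

/-- The critical probability `p_c(d) = inf {p ∈ [0,1] : θ_d(p) > 0}` (ROUTE-v1 §0).  For `d ≥ 1` the set
contains `1`; the definition uses the convention `sInf ∅ = 0` of `ℝ` and so makes sense for every `d`. -/
noncomputable def pc (d : ℕ) : ℝ := sInf (posSet d)

/-- `0 ≤ θ_d(p)`. -/
lemma θ_nonneg (d : ℕ) (p : unitInterval) : 0 ≤ θ d p := measureReal_nonneg

/-- `θ_d(p) ≤ 1`. -/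
lemma θ_le_one (d : ℕ) (p : unitInterval) : θ d p ≤ 1 := by
  unfold θ; exact measureReal_le_one

/-- The cluster of the origin under the all-closed configuration is `{0}`. -/
lemma cluster_bot : cluster (fun _ : Bond d => false) = {0} := by
  ext x
  simp only [cluster, Set.mem_setOf_eq, Set.mem_singleton_iff]
  constructor
  · intro h
    induction h with
    | refl => rfl
    | tail _ hxy ih =>
      obtain ⟨b, hb, -⟩ := hxy
      simp at hb
  · rintro rfl
    exact Relation.ReflTransGen.refl

/-- `θ(0) = 0`: under `P_0` every bond is closed, so the cluster of the origin is `{0}`. -/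
lemma θ_zero (d : ℕ) : θ d 0 = 0 := by
  unfold θ percMeasure
  simp only [bernoulliMeasure_zero]
  have h : (Measure.infinitePi fun _ : Bond d => (Measure.dirac false : Measure Bool)) =
      Measure.dirac (fun _ : Bond d => false) := by
    refine (Measure.eq_infinitePi _ ?_).symm
    intro s t ht
    rw [Measure.dirac_apply' _ (MeasurableSet.pi s.countable_toSet fun i _ => ht i)]
    classical
    by_cases hmem : (fun _ : Bond d => false) ∈ Set.pi (↑s) t
    · rw [Set.indicator_of_mem hmem, Pi.one_apply]
      symm
      refine Finset.prod_eq_one fun i hi => ?_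
      rw [Measure.dirac_apply' _ (ht i), Set.indicator_of_mem (hmem i hi), Pi.one_apply]
    · rw [Set.indicator_of_notMem hmem]
      symm
      simp only [Set.mem_pi, Finset.mem_coe, not_forall] at hmem
      obtain ⟨i, hi, hfi⟩ := hmem
      refine Finset.prod_eq_zero hi ?_
      rw [Measure.dirac_apply' _ (ht i), Set.indicator_of_notMem hfi]
  rw [h, measureReal_def, Measure.dirac_apply, Set.indicator_of_notMem]
  · simp
  · simp only [InfCluster, Set.mem_setOf_eq, cluster_bot]
    exact Set.not_infinite.2 (Set.finite_singleton 0)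

/-- `p_c(d) ∈ [0,1]`: the set `posSet d` lies in `[0,1]`, and `sInf ∅ = 0`. -/
lemma pc_mem (d : ℕ) : pc d ∈ unitInterval := by
  rcases (posSet d).eq_empty_or_nonempty with hS | ⟨q, hq⟩
  · simp only [pc, hS, Real.sInf_empty]
    exact unitInterval.zero_mem
  · have hbdd : BddBelow (posSet d) := ⟨0, fun p hp => hp.1.1⟩
    exact ⟨le_csInf ⟨q, hq⟩ fun p hp => hp.1.1, (csInf_le hbdd hq).trans hq.1.2⟩

/-- THE TARGET (README §1): for nearest-neighbour Bernoulli bond percolation on `ℤ^d`,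
`θ(p_c) = 0` for every `d ≥ 2`. -/
def Target : Prop := ∀ d : ℕ, 2 ≤ d → θ d ⟨pc d, pc_mem d⟩ = 0

end Summit.Ventures.PercRepro0
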